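import Mathlib.LinearAlgebra.Matrix.SchurComplement
import Mathlib.LinearAlgebra.Matrix.NonsingularInverse
import Mathlib.Logic.Equiv.Fin.Basic
import Literature.Computability.AlgebraicComplexity.DeterminantalComplexityProofs
import Literature.Computability.AlgebraicComplexity.StandardFamiliesProofs
import Summits.ValiantsHypothesis.ValiantsHypothesis.Theorems.PrincipalMinorColouringNormalForm

/-!
# `DetqpThesis` (stmt-ValiantsHypothesis-0315), line `fat-row-recursion` — stub S1:
# the row-partition normal form of an affine determinantal representation of `per_n`

Variables `e = (row, column) : Fin n × Fin n`, `per_n = perPoly (Fin n) ℂ = per (X (i, j))`.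
A ROW-PARTITIONED affine determinantal representation of `per_n` of size `M` is an affine matrix
`A` with `det A = per_n` (`IsAffineDetRepr`) together with `β : Fin M → Fin n` such that matrix
row `a` reads only the variables `x_{•, β a}` of column `β a`:
`coeff (single e 1) (A a b) ≠ 0 → e.2 = β a`.

`stub_normalForm` (S1 of the line): every affine determinantal representation of `per_n`
(`n ≥ 1`) of size `m` yields a row-partitioned one of size `M ≤ n · m` (here `M = n · m`
exactly).  Proof (Sylvester / Weinstein–Aronszajn regrouping by the column index of `x`):

1. `m ≥ 1`, since the empty determinant is `1` while `deg per_n = n ≥ 1`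
   (`totalDegree_perPoly_holds`).
2. Shift `x ↦ x + J`: `A(x + J) = B + Σ_e x_e A_e` with `B = A(J)` constant
   (`map_aeval_X_add_one_eq`), and `det B = per_n(J) = n! ≠ 0`
   (`constantCoeff_aeval_X_add_one`, `eval_one_perPoly`, `map_constantCoeff_shift`), exactly as
   in `PrincipalMinorColouring.normalForm_proof`.
3. `B + Σ_e x_e A_e = B · (1 + U · V)` with `U = (1_m | 1_m | ⋯ | 1_m)` (`n` copies, columns
   indexed by `Fin n × Fin m`) and `V` the stack of the column parts `B⁻¹ L_c`,
   `L_c = Σ_r x_{r,c} A_{(r,c)}`; Sylvester `Matrix.det_one_add_mul_comm` gives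
   `per_n(x + J) = n! · det (1 + V · U)`, and row `(c, k)` of `W := 1 + V · U` has entries
   `C(const) + Σ_r C(const) · x_{r,c}` — affine and supported on column `c`
   (`det_add_linearPart_eq_det_colBlocks`).
4. Un-shift with `ψ = aeval (x ↦ x − J)`: `ψ ∘ (x ↦ x + J) = id`, `ψ (det W) = det (W.map ψ)` and
   `ψ` keeps the shape `C c₀ + Σ_r C (c r) · x_{r,c}` (`aeval_X_sub_one_colAffine`).
5. Absorb `n!` into one row (`Matrix.det_updateRow_smul`), reindex
   `Fin n × Fin m ≃ Fin (n · m)` (`finProdFinEquiv`, `Matrix.det_reindex_self`), and put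
   `β a := (finProdFinEquiv.symm a).1`.

The shape `f = C c₀ + Σ_r C (c r) * X (r, col)` ("column-affine of column `col`") is carried as a
plain expression (no definition): it has total degree `≤ 1` (`totalDegree_colAffine_le_one`) and
`coeff (single e 1) f = 0` unless `e.2 = col` (`coeff_single_colAffine_eq_zero`).

Sources: J. J. Sylvester (1851) / Weinstein–Aronszajn, `det (1 + UV) = det (1 + VU)` (Mathlib
`Matrix.det_one_add_mul_comm`); T. Mignon, N. Ressayre, *A quadratic bound for the determinant
and permanent problem*, IMRN 2004, §1 (affine representations, the shift to a nonsingular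
point); C. Ikenmeyer, J. M. Landsberg, *On the complexity of the permanent in various
computational models*, JPAA 221 (2017), §6.  Not here: the other stubs of the line (deletion of a
column block, the fat-block bet, the telescoping lemma, Grenet's profile).
-/

-- single-conjunct layout: Sub = Summit, duplicated namespace component intended
set_option linter.dupNamespace false

noncomputable section

namespace Summit.ValiantsHypothesis.ValiantsHypothesis.Theorems.DetQPDetqpThesis.FatRowNormalForm

open MvPolynomial
open Literature.Computability.AlgebraicComplexity
open Summit.ValiantsHypothesis.Theorems.PrincipalMinorColouring

/-! ### Column-affine polynomials `C c₀ + Σ_r C (c r) · X (r, col)` -/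

section ColAffine

variable {k : Type*} [CommRing k] {ρ γ : Type*} [Fintype ρ]

/-- A column-affine polynomial `c₀ + Σ_r c_r · x_{r, col}` has total degree `≤ 1`. [folklore] -/
theorem totalDegree_colAffine_le_one (c₀ : k) (c : ρ → k) (col : γ) :
    (C c₀ + ∑ r, C (c r) * X (r, col) : MvPolynomial (ρ × γ) k).totalDegree ≤ 1 := by
  refine (totalDegree_add _ _).trans (max_le ?_ (totalDegree_finsetSum_le fun r _ => ?_))
  · rw [totalDegree_C]
    exact Nat.zero_le _
  · refine (totalDegree_mul _ _).trans ?_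
    rw [totalDegree_C, zero_add]
    simpa [X, Finsupp.sum_single_index] using
      totalDegree_monomial_le (R := k) (Finsupp.single ((r, col) : ρ × γ) 1) 1

/-- The coefficient of `x_e` in a column-affine polynomial `c₀ + Σ_r c_r · x_{r, col}` vanishes
unless `e` lies in column `col`. [folklore] -/
theorem coeff_single_colAffine_eq_zero [DecidableEq ρ] [DecidableEq γ] (c₀ : k) (c : ρ → k)
    (col : γ) (e : ρ × γ) (he : e.2 ≠ col) :
    coeff (Finsupp.single e 1) (C c₀ + ∑ r, C (c r) * X (r, col) : MvPolynomial (ρ × γ) k)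
      = 0 := by
  rw [coeff_add, coeff_C, if_neg, zero_add, coeff_sum]
  · refine Finset.sum_eq_zero fun r _ => ?_
    rw [coeff_C_mul, coeff_X, if_neg, mul_zero]
    intro h
    apply he
    rw [← Finsupp.single_left_injective one_ne_zero h]
  · intro h
    exact one_ne_zero (Finsupp.single_eq_zero.1 h.symm)

/-- The un-shift `x ↦ x − J` maps a column-affine polynomial of column `col` to a column-affine
polynomial of the same column (only the constant term changes). [folklore] -/
theorem aeval_X_sub_one_colAffine (c₀ : k) (c : ρ → k) (col : γ) :
    aeval (fun e : ρ × γ => (X e - 1 : MvPolynomial (ρ × γ) k))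
        (C c₀ + ∑ r, C (c r) * X (r, col)) =
      C (c₀ - ∑ r, c r) + ∑ r, C (c r) * X (r, col) := by
  simp only [map_add, map_sum, map_mul, map_sub, aeval_C, aeval_X, algebraMap_eq, mul_sub,
    mul_one, Finset.sum_sub_distrib]
  ring

/-- A constant multiple of a column-affine polynomial is column-affine (same column).
[folklore] -/
theorem C_mul_colAffine (a c₀ : k) (c : ρ → k) (col : γ) :
    (C a * (C c₀ + ∑ r, C (c r) * X (r, col)) : MvPolynomial (ρ × γ) k) =
      C (a * c₀) + ∑ r, C (a * c r) * X (r, col) := by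
  simp only [mul_add, Finset.mul_sum, map_mul, mul_assoc]

end ColAffine

/-! ### The Sylvester step, regrouped by the column index of `x` -/

section Sylvester

variable {k : Type*} [CommRing k] {ρ γ : Type*} [Fintype ρ] {m : ℕ}

/-- Entries of `B⁻¹ · L_c` for the column part `L_c = Σ_r x_{r,c} A_{(r,c)}`: column-affine of
column `c` with coefficients the entries of `B⁻¹ A_{(r,c)}`. [folklore] -/
theorem map_C_mul_colPart_apply (Binv : Matrix (Fin m) (Fin m) k)
    (Ae : ρ × γ → Matrix (Fin m) (Fin m) k) (col : γ) (i j : Fin m) :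
    (Binv.map C * Matrix.of (fun i j => ∑ r, C (Ae (r, col) i j) * X (r, col)) :
        Matrix (Fin m) (Fin m) (MvPolynomial (ρ × γ) k)) i j =
      ∑ r, C ((Binv * Ae (r, col)) i j) * X (r, col) := by
  simp only [Matrix.mul_apply, Matrix.map_apply, Matrix.of_apply, map_sum, map_mul,
    Finset.mul_sum, Finset.sum_mul]
  rw [Finset.sum_comm]
  refine Finset.sum_congr rfl fun r _ => Finset.sum_congr rfl fun t _ => ?_
  ring

/-- **Sylvester step regrouped by columns.** For a constant matrix `B` with `det B` a unit and
constant coefficient matrices `A_e` (`e : ρ × γ`), write `L_c = Σ_r x_{r,c} A_{(r,c)}`,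
`U = (1_m | ⋯ | 1_m)` (`γ` copies) and `V` = the stack of the `B⁻¹ L_c`; then
`B + Σ_e x_e A_e = B (1 + U V)` and `det (1 + U V) = det (1 + V U)`
(`Matrix.det_one_add_mul_comm`), where `(V U)_{(c,k),(c',k')} = (B⁻¹ L_c)_{k,k'}`.  Hence
`det (B + Σ_e x_e A_e) = det B · det W` with `W` indexed by `γ × Fin m` and row `(c, k)` of `W`
column-affine of column `c`. [folklore] -/
theorem det_add_linearPart_eq_det_colBlocks [Fintype γ] [DecidableEq γ]
    (B : Matrix (Fin m) (Fin m) k) (hB : IsUnit B.det) (Ae : ρ × γ → Matrix (Fin m) (Fin m) k) :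
    (B.map C + Matrix.of (fun i j => ∑ e, C (Ae e i j) * X e) :
        Matrix (Fin m) (Fin m) (MvPolynomial (ρ × γ) k)).det =
      C B.det * (Matrix.of fun p q : γ × Fin m =>
        (C (if p = q then (1 : k) else 0) + ∑ r, C ((B⁻¹ * Ae (r, p.1)) p.2 q.2) * X (r, p.1) :
          MvPolynomial (ρ × γ) k)).det := by
  -- the column parts `L c = Σ_r x_{r,c} A_{(r,c)}`
  let L : γ → Matrix (Fin m) (Fin m) (MvPolynomial (ρ × γ) k) :=
    fun c => Matrix.of fun i j => ∑ r, C (Ae (r, c) i j) * X (r, c)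
  have hL : (Matrix.of (fun i j => ∑ e, C (Ae e i j) * X e) :
      Matrix (Fin m) (Fin m) (MvPolynomial (ρ × γ) k)) = ∑ c, L c := by
    refine Matrix.ext fun i j => ?_
    rw [Matrix.sum_apply]
    simp only [Matrix.of_apply, L]
    rw [Fintype.sum_prod_type_right]
  -- `γ` copies of the identity side by side, and the stacked `B⁻¹ L_c`
  let U : Matrix (Fin m) (γ × Fin m) (MvPolynomial (ρ × γ) k) :=
    Matrix.of fun i p => if i = p.2 then 1 else 0
  let V : Matrix (γ × Fin m) (Fin m) (MvPolynomial (ρ × γ) k) :=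
    Matrix.of fun p j => (B⁻¹.map C * L p.1 : Matrix (Fin m) (Fin m) (MvPolynomial (ρ × γ) k)) p.2 j
  have hUV : U * V = B⁻¹.map C * ∑ c, L c := by
    refine Matrix.ext fun i j => ?_
    rw [Matrix.mul_sum, Matrix.sum_apply, Matrix.mul_apply, Fintype.sum_prod_type]
    refine Finset.sum_congr rfl fun c _ => ?_
    simp only [U, V, Matrix.of_apply, ite_mul, one_mul, zero_mul, Finset.sum_ite_eq,
      Finset.mem_univ, if_true]
  have hVU : ∀ p q, (V * U) p q = V p q.2 := by
    intro p q
    simp only [Matrix.mul_apply, U, Matrix.of_apply, mul_ite, mul_one, mul_zero,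
      Finset.sum_ite_eq', Finset.mem_univ, if_true]
  have hBinv : B * B⁻¹ = 1 := Matrix.mul_nonsing_inv B hB
  have hfactor : B.map (C (σ := ρ × γ)) + ∑ c, L c = B.map C * (1 + U * V) := by
    rw [hUV, Matrix.mul_add, Matrix.mul_one, ← Matrix.mul_assoc, ← Matrix.map_mul, hBinv,
      Matrix.map_one C C.map_zero C.map_one, Matrix.one_mul]
  rw [hL, hfactor, Matrix.det_mul, Matrix.det_one_add_mul_comm, RingHom.map_det,
    RingHom.mapMatrix_apply]
  congr 2
  refine Matrix.ext fun p q => ?_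
  rw [Matrix.add_apply, hVU, Matrix.one_apply, Matrix.of_apply]
  simp only [V, L, Matrix.of_apply]
  rw [map_C_mul_colPart_apply]
  congr 1
  split_ifs <;> simp

end Sylvester

/-! ### The stub -/

/-- **S1 — row-partition normal form (Sylvester regrouping by the column index of `x`).**
Every affine determinantal representation of `per_n` (`n ≥ 1`) of size `m` yields a
ROW-PARTITIONED one of size `M ≤ n · m`: an affine matrix `A'` with `det A' = per_n` and
`β : Fin M → Fin n` such that matrix row `a` of `A'` involves only the variables `x_{•, β a}`.
Proof: `m ≥ 1`; shift `x ↦ x + J` (`det A(J) = per_n(J) = n!`); Sylvester regrouping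
`det_add_linearPart_eq_det_colBlocks` (`M = n · m`, rows indexed by `Fin n × Fin m`, row `(c, k)`
column-affine of column `c`); un-shift `x ↦ x − J`; absorb `n!` into one row; reindex by
`finProdFinEquiv`. [folklore; Sylvester 1851; Mignon–Ressayre 2004, §1; Ikenmeyer–Landsberg
2017, §6] -/
theorem stub_normalForm :
    ∀ (n m : ℕ), 1 ≤ n → HasDetRepr (perPoly (Fin n) ℂ) m →
      ∃ M ≤ n * m, ∃ (A : Matrix (Fin M) (Fin M) (MvPolynomial (Fin n × Fin n) ℂ)) (β : Fin M → Fin n),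
        IsAffineDetRepr (perPoly (Fin n) ℂ) A ∧
        ∀ a b (e : Fin n × Fin n), coeff (Finsupp.single e 1) (A a b) ≠ 0 → e.2 = β a := by
  intro n m hn hA
  obtain ⟨A, haff, hdet⟩ := hA
  -- Step 1: `m ≥ 1`, the empty determinant being `1 ≠ per_n` (`deg per_n = n ≥ 1`)
  have hm : 0 < m := by
    rcases Nat.eq_zero_or_pos m with rfl | h
    · exfalso
      have h1 : A.det = 1 := Matrix.det_isEmpty
      have h2 := totalDegree_perPoly_holds (n := Fin n) (k := ℂ)
      rw [← hdet, h1, totalDegree_one, Fintype.card_fin] at h2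
      omega
    · exact h
  -- Step 2: the shift `x ↦ x + J`, `A(x + J) = B + Σ_e x_e A_e`, `det B = n!`
  have hshift := map_aeval_X_add_one_eq A haff
  set B : Matrix (Fin m) (Fin m) ℂ :=
    Matrix.of fun i j => coeff 0 (A i j) + ∑ e, coeff (Finsupp.single e 1) (A i j) with hBdef
  set Ae : Fin n × Fin n → Matrix (Fin m) (Fin m) ℂ :=
    fun e => Matrix.of fun i j => coeff (Finsupp.single e 1) (A i j) with hAedef
  have hdet' : aeval (fun e : Fin n × Fin n => (X e + 1 : MvPolynomial (Fin n × Fin n) ℂ))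
      (perPoly (Fin n) ℂ) =
      (B.map C + Matrix.of (fun i j => ∑ e, C (Ae e i j) * X e) :
        Matrix (Fin m) (Fin m) (MvPolynomial (Fin n × Fin n) ℂ)).det := by
    rw [← hdet, AlgHom.map_det, AlgHom.mapMatrix_apply, hshift]
  have hBdet : B.det = (n.factorial : ℂ) := by
    have h := congrArg constantCoeff hdet'
    rw [constantCoeff_aeval_X_add_one, eval_one_perPoly, RingHom.map_det, RingHom.mapMatrix_apply,
      map_constantCoeff_shift] at h
    exact h.symm
  have hBunit : IsUnit B.det := by
    rw [hBdet, isUnit_iff_ne_zero, Nat.cast_ne_zero]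
    exact Nat.factorial_ne_zero n
  -- Step 3: Sylvester, regrouped by the column index
  rw [det_add_linearPart_eq_det_colBlocks B hBunit Ae, hBdet] at hdet'
  -- Step 4: un-shift with `ψ = aeval (x ↦ x - J)`
  have hψid : ∀ p : MvPolynomial (Fin n × Fin n) ℂ,
      aeval (fun e : Fin n × Fin n => (X e - 1 : MvPolynomial (Fin n × Fin n) ℂ))
        (aeval (fun e : Fin n × Fin n => (X e + 1 : MvPolynomial (Fin n × Fin n) ℂ)) p) = p := by
    have hfun : (fun e : Fin n × Fin n =>
        aeval (fun e : Fin n × Fin n => (X e - 1 : MvPolynomial (Fin n × Fin n) ℂ))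
          (X e + 1 : MvPolynomial (Fin n × Fin n) ℂ)) = X := by
      funext e
      rw [map_add, map_one, aeval_X, sub_add_cancel]
    intro p
    rw [comp_aeval_apply, hfun, aeval_X_left_apply]
  obtain ⟨W₂, hW₂def⟩ : ∃ W₂ : Matrix (Fin n × Fin m) (Fin n × Fin m)
      (MvPolynomial (Fin n × Fin n) ℂ), W₂ = Matrix.of fun p q =>
        C ((if p = q then (1 : ℂ) else 0) - ∑ r, (B⁻¹ * Ae (r, p.1)) p.2 q.2) +
          ∑ r, C ((B⁻¹ * Ae (r, p.1)) p.2 q.2) * X (r, p.1) := ⟨_, rfl⟩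
  have hW₂ : perPoly (Fin n) ℂ = C (n.factorial : ℂ) * W₂.det := by
    have h := congrArg
      (aeval fun e : Fin n × Fin n => (X e - 1 : MvPolynomial (Fin n × Fin n) ℂ)) hdet'
    rw [hψid, map_mul, aeval_C, algebraMap_eq, AlgHom.map_det, AlgHom.mapMatrix_apply] at h
    rw [h]
    congr 2
    refine Matrix.ext fun p q => ?_
    rw [hW₂def, Matrix.map_apply, Matrix.of_apply, Matrix.of_apply]
    exact aeval_X_sub_one_colAffine _ _ _
  -- Step 5: absorb `n!` into the row `p₀`
  obtain ⟨p₀⟩ : Nonempty (Fin n × Fin m) := ⟨(⟨0, hn⟩, ⟨0, hm⟩)⟩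
  obtain ⟨W₃, hW₃def⟩ : ∃ W₃ : Matrix (Fin n × Fin m) (Fin n × Fin m)
      (MvPolynomial (Fin n × Fin n) ℂ),
      W₃ = W₂.updateRow p₀ ((C (n.factorial : ℂ) : MvPolynomial (Fin n × Fin n) ℂ) • W₂ p₀) :=
    ⟨_, rfl⟩
  have hW₃det : W₃.det = perPoly (Fin n) ℂ := by
    rw [hW₃def, Matrix.det_updateRow_smul, Matrix.updateRow_eq_self, hW₂]
  have hW₃ : ∀ p q, ∃ (c₀ : ℂ) (c : Fin n → ℂ),
      W₃ p q = C c₀ + ∑ r, C (c r) * X (r, p.1) := by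
    intro p q
    rw [hW₃def, Matrix.updateRow_apply]
    by_cases hp : p = p₀
    · rw [if_pos hp, Pi.smul_apply, smul_eq_mul, hW₂def, Matrix.of_apply, C_mul_colAffine, hp]
      exact ⟨_, _, rfl⟩
    · rw [if_neg hp, hW₂def, Matrix.of_apply]
      exact ⟨_, _, rfl⟩
  -- Step 6: reindex `Fin n × Fin m ≃ Fin (n * m)`; `β a = (column class of row a)`
  refine ⟨n * m, le_rfl, Matrix.reindex finProdFinEquiv finProdFinEquiv W₃,
    fun a => (finProdFinEquiv.symm a).1, ⟨fun a b => ?_, ?_⟩, fun a b e he => ?_⟩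
  · obtain ⟨c₀, c, h⟩ := hW₃ (finProdFinEquiv.symm a) (finProdFinEquiv.symm b)
    rw [Matrix.reindex_apply, Matrix.submatrix_apply, h]
    exact totalDegree_colAffine_le_one _ _ _
  · rw [Matrix.det_reindex_self, hW₃det]
  · by_contra hne
    obtain ⟨c₀, c, h⟩ := hW₃ (finProdFinEquiv.symm a) (finProdFinEquiv.symm b)
    rw [Matrix.reindex_apply, Matrix.submatrix_apply, h] at he
    exact he (coeff_single_colAffine_eq_zero _ _ _ _ hne)

end Summit.ValiantsHypothesis.ValiantsHypothesis.Theorems.DetQPDetqpThesis.FatRowNormalForm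

end
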